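import Literature.Barriers.CriticalPhenomena.LaceExpansionIsingDeconvolutionParts
import Literature.Barriers.CriticalPhenomena.GaussianDominationRouteNobleProofs
import HarnessLib

/-!
# Liu–Slade's Theorem 1.7, assembly part I: the elementary estimates (2.5)–(2.6)

Barrier catalogue `Literature/Barriers/CriticalPhenomena/` (D-0021), companion of
`LaceExpansionIsingDeconvolutionParts.lean` (the objects `lsF`, `lsLambda`, `lsMu`, `LSAssumptionF`
of Liu–Slade 2026, §2.1, and the named inputs of the proof of Theorem 1.7). This file PROVES the
in-text consequences of Assumption 2.1 that the proof of Theorem 1.7 uses without numbering them: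

* summability and moment bounds under the two-parameter decay bound
  `|Π(x)| ≤ β₀δ_{0,x} + β₁/⟦x⟧^s` of (2.2) (`summable_abs_of_lsBound`, `tsum_abs_le_of_lsBound`,
  `tsum_sq_mul_abs_le_of_lsBound`: `Σ|Π| ≤ β₀ + β₁Σ⟦x⟧^{-s}`, `Σ|x|²|Π(x)| ≤ β₁Σ⟦x⟧^{-(s-2)}`);
* the sums of `F_z = δ - zD - Π_z`: `F̂_z(0) = 1 - z - Σ_xΠ_z(x)` ((2.5)) and
  `Σ_x|x|²F_z(x) = -zσ² - Σ_x|x|²Π_z(x)` (`hasSum_lsF`, `hasSum_sq_mul_lsF`), whence the formula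
  (2.6) `λ_z = 1/(F̂_z(0) + z + σ^{-2}Σ|x|²Π_z(x))` (`lsLambda_lsF_eq`), with `σ² ≥ 1` for the
  punctured-cube step distribution (`one_le_soVariance`); `Σ δ₀ = 1` is the tree's `hasSum_delta0`
  (`GaussianDominationRouteNobleProofs.lean`);
* **(2.5)–(2.6) quantitatively** (`exists_lsLambda_estimates`): a constant `K = K(d, ρ)` with
  `z ≤ 1 + Kβ`, `0 ≤ F̂_z(0) ≤ Kβ`, `|Σ Π_z| ≤ Kβ`, `|Σ|x|²Π_z| ≤ Kβ₁`, `0 < λ_z ≤ 2`,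
  `|λ_z - 1| ≤ 2Kβ`, `μ_z ∈ [0, 1]`, `1 - μ_z ≤ 2Kβ` whenever `Kβ ≤ 1/2` (`β = β₀ ∨ β₁`) — the
  source's "`λ_z = 1 + O(β)`", "`μ_z ∈ [1 - O(β), 1]`, so it makes sense to write `S_{μ_z}`";
* "`S_{μ_z}(x) ≤ S_1(x)`" of (2.16): `0 ≤ S_μ ≤ S_1` for `μ ∈ [0, 1]` once `Σ_n D^{*n}(x)`
  converges (`soGreen_le_soGreen_one`; convergence is the tree's transience
  `summable_convPow`).

## References

* Y. Liu, G. Slade, *Gaussian deconvolution and the lace expansion for spread-out models*,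
  Ann. Inst. H. Poincaré Probab. Statist. 62 (2026), arXiv:2310.07640: (1.6), §1.2.1 (`σ²`),
  Assumption 2.1 with (2.2), (2.4), (2.5)–(2.6), (2.16) [LiuSlade2026].
-/

noncomputable section

namespace Literature.Barriers.CriticalPhenomena.SpreadOutIsing

open Filter UnitAddTorus Literature.Probability.LatticeModels
open _root_.MeasureTheory _root_.Topology

section Estimates

variable {d L : ℕ}

/-! ## Summability and sums under the two-parameter decay bound `β₀ δ + β₁/⟦x⟧^s` -/

/-- A bound `|P(x)| ≤ β₀δ_{0,x} + β₁/⟦x⟧^s` with `β₀ ≥ 0` gives `|P(x)| ≤ (β₀ + β₁)/⟦x⟧^s`.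
[cite: LiuSlade2026, (2.2)] -/
theorem abs_le_div_jnorm_of_lsBound {P : Site d → ℝ} {β₀ β₁ s : ℝ} (hβ₀ : 0 ≤ β₀)
    (h : ∀ x, |P x| ≤ β₀ * delta0 x + β₁ / jnorm x ^ s) (x : Site d) :
    |P x| ≤ (β₀ + β₁) / jnorm x ^ s := by
  have hj : 0 < jnorm x ^ s := Real.rpow_pos_of_pos (jnorm_pos x) s
  refine (h x).trans ?_
  by_cases hx : x = 0
  · subst hx
    simp [jnorm_zero, Real.one_rpow]
  · rw [delta0_of_ne_zero hx, mul_zero, zero_add, add_div]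
    have : 0 ≤ β₀ / jnorm x ^ s := div_nonneg hβ₀ hj.le
    linarith

/-- Summability of `|P|` under the decay bound with `s > d`. [cite: LiuSlade2026, (2.2)] -/
theorem summable_abs_of_lsBound {P : Site d → ℝ} {β₀ β₁ s : ℝ} (hβ₀ : 0 ≤ β₀)
    (h : ∀ x, |P x| ≤ β₀ * delta0 x + β₁ / jnorm x ^ s) (hs : (d : ℝ) < s) :
    Summable fun x => |P x| :=
  summable_abs_of_decay (abs_le_div_jnorm_of_lsBound hβ₀ h) hs

/-- Summability of `P` under the decay bound with `s > d`. [cite: LiuSlade2026, (2.2)] -/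
theorem summable_of_lsBound {P : Site d → ℝ} {β₀ β₁ s : ℝ} (hβ₀ : 0 ≤ β₀)
    (h : ∀ x, |P x| ≤ β₀ * delta0 x + β₁ / jnorm x ^ s) (hs : (d : ℝ) < s) : Summable P :=
  (summable_abs_of_lsBound hβ₀ h hs).of_abs

/-- Summability of `|x|² |P(x)|` under the decay bound with `s - 2 > d`. [cite: LiuSlade2026, (2.2)] -/
theorem summable_sq_mul_abs_of_lsBound {P : Site d → ℝ} {β₀ β₁ s : ℝ} (hβ₀ : 0 ≤ β₀)
    (h : ∀ x, |P x| ≤ β₀ * delta0 x + β₁ / jnorm x ^ s) (hs : (d : ℝ) < s - 2) :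
    Summable fun x => euclidNorm x ^ 2 * |P x| := by
  have h2 := summable_rpow_mul_abs_of_decay (abs_le_div_jnorm_of_lsBound hβ₀ h) zero_le_two hs
  refine h2.congr fun x => ?_
  rw [Real.rpow_two]

/-- Summability of `|x|² P(x)` under the decay bound with `s - 2 > d`. [cite: LiuSlade2026, (2.2)] -/
theorem summable_sq_mul_of_lsBound {P : Site d → ℝ} {β₀ β₁ s : ℝ} (hβ₀ : 0 ≤ β₀)
    (h : ∀ x, |P x| ≤ β₀ * delta0 x + β₁ / jnorm x ^ s) (hs : (d : ℝ) < s - 2) :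
    Summable fun x => euclidNorm x ^ 2 * P x := by
  refine (summable_sq_mul_abs_of_lsBound hβ₀ h hs).of_norm_bounded (fun x => ?_)
  rw [Real.norm_eq_abs, abs_mul, abs_of_nonneg (sq_nonneg (euclidNorm x))]

/-- `Σ_x |P(x)| ≤ β₀ + β₁ Σ_x ⟦x⟧^{-s}` under the decay bound (`s > d`, `β₁ ≥ 0`).
[cite: LiuSlade2026, (2.2) and (2.5)] -/
theorem tsum_abs_le_of_lsBound {P : Site d → ℝ} {β₀ β₁ s : ℝ} (hβ₀ : 0 ≤ β₀)
    (h : ∀ x, |P x| ≤ β₀ * delta0 x + β₁ / jnorm x ^ s) (hs : (d : ℝ) < s) :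
    ∑' x, |P x| ≤ β₀ + β₁ * ∑' x : Site d, jnorm x ^ (-s) := by
  have hδ : HasSum (fun x : Site d => β₀ * delta0 x) β₀ := by
    have := (hasSum_ite_eq (0 : Site d) β₀)
    refine this.congr_fun fun x => ?_  -- careful orientation
    unfold delta0; split_ifs <;> simp [*]
  have hJ : Summable fun x : Site d => jnorm x ^ (-s) := summable_jnorm_rpow_neg hs
  have hrhs : HasSum (fun x : Site d => β₀ * delta0 x + β₁ * jnorm x ^ (-s))
      (β₀ + β₁ * ∑' x : Site d, jnorm x ^ (-s)) := hδ.add (hJ.hasSum.mul_left β₁)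
  refine hasSum_le (fun x => ?_) (summable_abs_of_lsBound hβ₀ h hs).hasSum hrhs
  rw [Real.rpow_neg (jnorm_pos x).le, ← div_eq_mul_inv]
  exact h x

/-- `Σ_x |x|²|P(x)| ≤ β₁ Σ_x ⟦x⟧^{-(s-2)}` under the decay bound (`s - 2 > d`, `β₁ ≥ 0`): the `δ`-part
carries no second moment. [cite: LiuSlade2026, (2.2) and (2.6)] -/
theorem tsum_sq_mul_abs_le_of_lsBound {P : Site d → ℝ} {β₀ β₁ s : ℝ} (hβ₀ : 0 ≤ β₀) (hβ₁ : 0 ≤ β₁)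
    (h : ∀ x, |P x| ≤ β₀ * delta0 x + β₁ / jnorm x ^ s) (hs : (d : ℝ) < s - 2) :
    ∑' x, euclidNorm x ^ 2 * |P x| ≤ β₁ * ∑' x : Site d, jnorm x ^ (-(s - 2)) := by
  have hJ : Summable fun x : Site d => jnorm x ^ (-(s - 2)) := summable_jnorm_rpow_neg hs
  refine hasSum_le (fun x => ?_) (summable_sq_mul_abs_of_lsBound hβ₀ h hs).hasSum
    (hJ.hasSum.mul_left β₁)
  have hj := jnorm_pos x
  by_cases hx : x = 0
  · subst hx
    simp only [euclidNorm_zero', ne_eq, OfNat.ofNat_ne_zero, not_false_eq_true, zero_pow, zero_mul]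
    exact mul_nonneg hβ₁ (Real.rpow_nonneg hj.le _)
  · have hb : |P x| ≤ β₁ / jnorm x ^ s := by
      have := h x; rwa [delta0_of_ne_zero hx, mul_zero, zero_add] at this
    calc euclidNorm x ^ 2 * |P x| ≤ jnorm x ^ (2 : ℝ) * (β₁ / jnorm x ^ s) := by
          refine mul_le_mul ?_ hb (abs_nonneg _) (Real.rpow_nonneg hj.le _)
          rw [Real.rpow_two]
          exact pow_le_pow_left₀ (euclidNorm_nonneg x) (euclidNorm_le_jnorm x) 2
      _ = β₁ * jnorm x ^ (-(s - 2)) := by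
          rw [Real.rpow_neg hj.le, Real.rpow_sub hj, inv_div]
          ring

/-! ## The step distribution: second moment, `σ² ≥ 1` -/

/-- `Σ_x |x|² D(x) = σ²` as a series. [cite: LiuSlade2026, §1.2.1 (σ² = Σ|x|²D(x))] -/
theorem hasSum_sq_mul_soStep :
    HasSum (fun x : Site d => euclidNorm x ^ 2 * soStep d L x) (soVariance d L) := by
  have h : ∀ x ∉ (spreadOutGraph d L).neighborFinset 0, euclidNorm x ^ 2 * soStep d L x = 0 :=
    fun x hx => by
      rw [soStep_of_not_adj fun h => hx ((SimpleGraph.mem_neighborFinset _ _ _).2 h), mul_zero]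
  have h2 : soVariance d L =
      ∑ x ∈ (spreadOutGraph d L).neighborFinset 0, euclidNorm x ^ 2 * soStep d L x := by
    unfold soVariance
    refine Finset.sum_congr rfl fun x hx => ?_
    rw [soStep, if_pos ((SimpleGraph.mem_neighborFinset _ _ _).1 hx)]
  rw [h2]
  exact hasSum_sum_of_ne_finset_zero h

/-- **`σ² ≥ 1`** for `d, L ≥ 1`: every neighbour `x` of the origin has `|x| ≥ 1`, so
`σ² = Σ_x |x|² D(x) ≥ Σ_x D(x) = 1`. [cite: LiuSlade2026, §1.2.1 (σ² ≍ L²)] -/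
theorem one_le_soVariance (hd : 1 ≤ d) (hL : 1 ≤ L) : 1 ≤ soVariance d L := by
  rw [← sum_soStep_eq_one hd hL]
  unfold soVariance
  refine Finset.sum_le_sum fun x hx => ?_
  have hadj := (SimpleGraph.mem_neighborFinset _ _ _).1 hx
  rw [soStep, if_pos hadj]
  have hx0 : x ≠ 0 := hadj.ne.symm
  have h1 : 1 ≤ euclidNorm x ^ 2 := by
    have := one_le_euclidNorm_of_ne_zero hx0
    nlinarith
  have hN : (0 : ℝ) ≤ ((soCount d L : ℝ))⁻¹ := by positivity
  nlinarith

/-- `|x|² δ_{0,x} = 0`. [folklore] -/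
theorem sq_mul_delta0 (x : Site d) : euclidNorm x ^ 2 * delta0 x = 0 := by
  by_cases hx : x = 0
  · subst hx; simp
  · rw [delta0_of_ne_zero hx, mul_zero]

/-! ## Sums of `F_z = δ - zD - Π_z`: `F̂_z(0)` and `Σ|x|²F_z(x)` -/

/-- `Σ_x F_z(x) = 1 - z - Σ_x Π_z(x)` (`d, L ≥ 1`, `Π_z` summable). [cite: LiuSlade2026, (2.5) (F̂_z(0) = 1 - z - Π̂_z(0))] -/
theorem hasSum_lsF (hd : 1 ≤ d) (hL : 1 ≤ L) (z : ℝ) {P : Site d → ℝ} (hP : Summable P) :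
    HasSum (lsF d L z P) (1 - z - ∑' x, P x) := by
  have h := (hasSum_delta0.sub ((hasSum_soStep hd hL).mul_left z)).sub hP.hasSum
  rw [mul_one] at h
  exact h

/-- `Σ_x |x|² F_z(x) = -zσ² - Σ_x |x|² Π_z(x)`. [cite: LiuSlade2026, (2.4) and (2.6)] -/
theorem hasSum_sq_mul_lsF (z : ℝ) {P : Site d → ℝ} (hP2 : Summable fun x => euclidNorm x ^ 2 * P x) :
    HasSum (fun x => euclidNorm x ^ 2 * lsF d L z P x)
      (-(z * soVariance d L) - ∑' x, euclidNorm x ^ 2 * P x) := by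
  have hδ : HasSum (fun x : Site d => euclidNorm x ^ 2 * delta0 x) 0 := by
    simp_rw [sq_mul_delta0]; exact hasSum_zero
  have h := (hδ.sub ((hasSum_sq_mul_soStep (d := d) (L := L)).mul_left z)).sub hP2.hasSum
  rw [zero_sub] at h
  refine h.congr_fun fun x => ?_
  show euclidNorm x ^ 2 * lsF d L z P x = _
  simp only [lsF]
  ring

/-- **The formula (2.6) for `λ_z`**: `λ_z = 1/(F̂_z(0) + z + σ^{-2} Σ_x |x|² Π_z(x))`.
[cite: LiuSlade2026, (2.6)] -/
theorem lsLambda_lsF_eq (hd : 1 ≤ d) (hL : 1 ≤ L) (z : ℝ) {P : Site d → ℝ}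
    (hP2 : Summable fun x => euclidNorm x ^ 2 * P x) :
    lsLambda d L (lsF d L z P) =
      ((∑' x, lsF d L z P x) + z + (soVariance d L)⁻¹ * ∑' x, euclidNorm x ^ 2 * P x)⁻¹ := by
  have hσ : soVariance d L ≠ 0 := (lt_of_lt_of_le one_pos (one_le_soVariance hd hL)).ne'
  rw [lsLambda, (hasSum_sq_mul_lsF z hP2).tsum_eq]
  congr 1
  field_simp
  ring

/-! ## The estimates (2.5)–(2.6): `z = 1 + O(β)`, `0 ≤ F̂_z(0) ≤ O(β)`, `λ_z = 1 + O(β)`, `μ_z ∈ [1 - O(β), 1]` -/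

/-- The lattice constant `Σ_x ⟦x⟧^{-(d+ρ)}` controlling the moments of `Π_z` is at least `1`
(its `x = 0` term). [folklore] -/
theorem one_le_tsum_jnorm_rpow_neg {s : ℝ} (hs : (d : ℝ) < s) :
    1 ≤ ∑' x : Site d, jnorm x ^ (-s) := by
  have h := (summable_jnorm_rpow_neg hs).le_tsum (0 : Site d)
    (fun b _ => Real.rpow_nonneg (jnorm_pos b).le _)
  have h0 : jnorm (0 : Site d) ^ (-s) = 1 := by rw [jnorm_zero, Real.one_rpow]
  rw [h0] at h
  exact h

/-- **Liu–Slade 2026, (2.5)–(2.6)**, quantitatively: there is a constant `K = K(d, ρ) > 0` such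
that, for `d, L ≥ 1` and every `(z, β₀, β₁, Π_z)` satisfying Assumption 2.1 with
`K·(β₀ ∨ β₁) ≤ 1/2`: "`1 ≤ z ≤ 1 - Π̂_z(0) ≤ 1 + O(β)`", "`0 ≤ F̂_z(0) ≤ O(β)`",
"`λ_z = 1/(F̂_z(0) + z + σ^{-2}Σ|x|²Π_z(x)) = 1 + O(β)`" (with `λ_z > 0`, `λ_z ≤ 2`), and
"`μ_z ∈ [1 - O(β), 1]`" (with `μ_z ≥ 0`); also `|Σ_x Π_z(x)| ≤ Kβ` and `|Σ_x |x|²Π_z(x)| ≤ Kβ₁`.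
Here `K = 2 + 3Σ_x⟦x⟧^{-(d+ρ)}` and `σ² ≥ 1` is used in place of the source's "`O(βσ^{-2})`".
[cite: LiuSlade2026, (2.5)–(2.6)] -/
theorem exists_lsLambda_estimates (d : ℕ) (hd : 1 ≤ d) {ρ : ℝ} (hρ : 0 < ρ) :
    ∃ K : ℝ, 0 < K ∧ ∀ (L : ℕ), 1 ≤ L → ∀ (β₀ β₁ z : ℝ) (P : Site d → ℝ), 0 ≤ β₀ → 0 ≤ β₁ →
      K * max β₀ β₁ ≤ 1 / 2 → LSAssumptionF d L ρ β₀ β₁ z P →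
        z ≤ 1 + K * max β₀ β₁ ∧
        (0 ≤ ∑' x, lsF d L z P x ∧ ∑' x, lsF d L z P x ≤ K * max β₀ β₁) ∧
        |∑' x, P x| ≤ K * max β₀ β₁ ∧
        |∑' x, euclidNorm x ^ 2 * P x| ≤ K * β₁ ∧
        (0 < lsLambda d L (lsF d L z P) ∧ lsLambda d L (lsF d L z P) ≤ 2 ∧
          |lsLambda d L (lsF d L z P) - 1| ≤ 2 * K * max β₀ β₁) ∧
        (0 ≤ lsMu d L (lsF d L z P) ∧ lsMu d L (lsF d L z P) ≤ 1 ∧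
          1 - lsMu d L (lsF d L z P) ≤ 2 * K * max β₀ β₁) := by
  have hs0 : (d : ℝ) < (d : ℝ) + 2 + ρ := by linarith
  have hs2 : (d : ℝ) < (d : ℝ) + 2 + ρ - 2 := by linarith
  set Cρ : ℝ := ∑' x : Site d, jnorm x ^ (-((d : ℝ) + 2 + ρ - 2)) with hCρ
  have hCρ1 : 1 ≤ Cρ := one_le_tsum_jnorm_rpow_neg hs2
  -- the smaller constant `Σ ⟦x⟧^{-(d+2+ρ)} ≤ Cρ`
  have hC'le : ∑' x : Site d, jnorm x ^ (-((d : ℝ) + 2 + ρ)) ≤ Cρ := by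
    refine (summable_jnorm_rpow_neg hs0).tsum_le_tsum (fun x => ?_) (summable_jnorm_rpow_neg hs2)
    exact Real.rpow_le_rpow_of_exponent_le (one_le_jnorm x) (by linarith)
  refine ⟨2 + 3 * Cρ, by linarith, fun L hL β₀ β₁ z P hβ₀ hβ₁ hsmall hA => ?_⟩
  obtain ⟨hz1, hsymm, hbd, hF0⟩ := hA
  set β : ℝ := max β₀ β₁ with hβ
  set K : ℝ := 2 + 3 * Cρ with hK
  have hβ0' : β₀ ≤ β := le_max_left _ _
  have hβ1' : β₁ ≤ β := le_max_right _ _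
  have hβnn : 0 ≤ β := hβ₀.trans hβ0'
  have hKβ : K * β ≤ 1 / 2 := hsmall
  -- summability
  have hPs : Summable P := summable_of_lsBound hβ₀ hbd hs0
  have hPabs : Summable fun x => |P x| := summable_abs_of_lsBound hβ₀ hbd hs0
  have hP2 : Summable fun x => euclidNorm x ^ 2 * P x := summable_sq_mul_of_lsBound hβ₀ hbd hs2
  have hP2abs : Summable fun x => euclidNorm x ^ 2 * |P x| :=
    summable_sq_mul_abs_of_lsBound hβ₀ hbd hs2
  -- `|Σ Π| ≤ β₀ + β₁ Cρ ≤ K β`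
  have hS0 : |∑' x, P x| ≤ β₀ + β₁ * Cρ := by
    have habs : |∑' x, P x| ≤ ∑' x, |P x| := by
      have := norm_tsum_le_tsum_norm (f := P) (by simpa only [Real.norm_eq_abs] using hPabs)
      simpa only [Real.norm_eq_abs] using this
    refine habs.trans ?_
    refine (tsum_abs_le_of_lsBound hβ₀ hbd hs0).trans ?_
    have := mul_le_mul_of_nonneg_left hC'le hβ₁
    linarith
  have hS0K : β₀ + β₁ * Cρ ≤ K * β := by
    rw [hK]
    have : β₁ * Cρ ≤ β * Cρ := mul_le_mul_of_nonneg_right hβ1' (by linarith)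
    nlinarith
  -- `|Σ |x|² Π| ≤ β₁ Cρ`
  have hS2 : |∑' x, euclidNorm x ^ 2 * P x| ≤ β₁ * Cρ := by
    have h1 : |∑' x, euclidNorm x ^ 2 * P x| ≤ ∑' x, euclidNorm x ^ 2 * |P x| := by
      have habs' : Summable fun x => ‖euclidNorm x ^ 2 * P x‖ := by
        refine hP2abs.congr fun x => ?_
        rw [Real.norm_eq_abs, abs_mul, abs_of_nonneg (sq_nonneg (euclidNorm x))]
      have := norm_tsum_le_tsum_norm habs'
      rw [Real.norm_eq_abs] at this
      refine this.trans_eq (tsum_congr fun x => ?_)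
      rw [Real.norm_eq_abs, abs_mul, abs_of_nonneg (sq_nonneg (euclidNorm x))]
    exact h1.trans (tsum_sq_mul_abs_le_of_lsBound hβ₀ hβ₁ hbd hs2)
  -- `F̂(0) = 1 - z - ΣΠ`
  have hF : ∑' x, lsF d L z P x = 1 - z - ∑' x, P x := (hasSum_lsF hd hL z hPs).tsum_eq
  have hσ1 : 1 ≤ soVariance d L := one_le_soVariance hd hL
  have hσpos : 0 < soVariance d L := lt_of_lt_of_le one_pos hσ1
  -- (2.5)
  have hzle : z ≤ 1 + K * β := by
    have h := abs_le.1 (hS0.trans hS0K)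
    rw [hF] at hF0
    linarith
  have hFle : ∑' x, lsF d L z P x ≤ K * β := by
    have h := abs_le.1 (hS0.trans hS0K)
    rw [hF]
    linarith
  -- the denominator of `λ`
  have hS2σ : |(soVariance d L)⁻¹ * ∑' x, euclidNorm x ^ 2 * P x| ≤ K * β := by
    rw [abs_mul, abs_of_pos (inv_pos.2 hσpos)]
    have h1 : (soVariance d L)⁻¹ ≤ 1 := inv_le_one_of_one_le₀ hσ1
    calc (soVariance d L)⁻¹ * |∑' x, euclidNorm x ^ 2 * P x|
        ≤ 1 * (β₁ * Cρ) := mul_le_mul h1 hS2 (abs_nonneg _) zero_le_one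
      _ ≤ K * β := by
          rw [one_mul, hK]
          have : β₁ * Cρ ≤ β * Cρ := mul_le_mul_of_nonneg_right hβ1' (by linarith)
          nlinarith
  set Dz : ℝ := (∑' x, lsF d L z P x) + z + (soVariance d L)⁻¹ * ∑' x, euclidNorm x ^ 2 * P x
    with hDz
  have hlam : lsLambda d L (lsF d L z P) = Dz⁻¹ := lsLambda_lsF_eq hd hL z hP2
  -- `Dz = 1 - ΣΠ + σ⁻² Σ|x|²Π`, so `|Dz - 1| ≤ Kβ ≤ 1/2`
  have hD1 : |Dz - 1| ≤ K * β := by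
    have hrepr : Dz - 1 = -(∑' x, P x) + (soVariance d L)⁻¹ * ∑' x, euclidNorm x ^ 2 * P x := by
      rw [hDz, hF]; ring
    rw [hrepr]
    refine (abs_add_le _ _).trans ?_
    rw [abs_neg]
    have h2 : |(soVariance d L)⁻¹ * ∑' x, euclidNorm x ^ 2 * P x| ≤ β₁ * Cρ := by
      rw [abs_mul, abs_of_pos (inv_pos.2 hσpos)]
      calc (soVariance d L)⁻¹ * |∑' x, euclidNorm x ^ 2 * P x|
          ≤ 1 * (β₁ * Cρ) := mul_le_mul (inv_le_one_of_one_le₀ hσ1) hS2 (abs_nonneg _) zero_le_one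
        _ = β₁ * Cρ := one_mul _
    have h3 : β₀ + β₁ * Cρ + β₁ * Cρ ≤ K * β := by
      rw [hK]
      have : β₁ * Cρ ≤ β * Cρ := mul_le_mul_of_nonneg_right hβ1' (by linarith)
      nlinarith
    linarith [hS0, h2, h3]
  have hDlow : 1 / 2 ≤ Dz := by
    have := (abs_le.1 hD1).1; linarith
  have hDpos : 0 < Dz := by linarith
  -- λ
  have hlampos : 0 < lsLambda d L (lsF d L z P) := by rw [hlam]; exact inv_pos.2 hDpos
  have hlamle2 : lsLambda d L (lsF d L z P) ≤ 2 := by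
    rw [hlam]
    calc Dz⁻¹ ≤ (1 / 2)⁻¹ := inv_anti₀ (by norm_num) hDlow
      _ = 2 := by norm_num
  have hlam1 : |lsLambda d L (lsF d L z P) - 1| ≤ 2 * K * β := by
    rw [hlam]
    have hrepr : Dz⁻¹ - 1 = (1 - Dz) / Dz := by field_simp
    rw [hrepr, abs_div, abs_of_pos hDpos, div_le_iff₀ hDpos, abs_sub_comm]
    have hKβnn : 0 ≤ K * β := mul_nonneg (by linarith) hβnn
    calc |Dz - 1| ≤ K * β := hD1
      _ = 2 * K * β * (1 / 2) := by ring
      _ ≤ 2 * K * β * Dz := mul_le_mul_of_nonneg_left hDlow (by linarith)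
  -- μ
  have hμ : lsMu d L (lsF d L z P) = 1 - Dz⁻¹ * ∑' x, lsF d L z P x := by
    rw [lsMu, hlam]
  have hlamF_nn : 0 ≤ Dz⁻¹ * ∑' x, lsF d L z P x := mul_nonneg (inv_pos.2 hDpos).le hF0
  have hlamF_le1 : Dz⁻¹ * ∑' x, lsF d L z P x ≤ 1 := by
    rw [inv_mul_le_iff₀ hDpos, mul_one]
    -- `ΣF ≤ Dz` since `Dz - ΣF = z + σ⁻²Σ|x|²Π ≥ 1 - Kβ > 0`
    have h2 := (abs_le.1 hS2σ).1
    rw [hDz]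
    linarith
  have hlamF_le : Dz⁻¹ * ∑' x, lsF d L z P x ≤ 2 * K * β := by
    calc Dz⁻¹ * ∑' x, lsF d L z P x ≤ 2 * (K * β) :=
          mul_le_mul (hlam ▸ hlamle2) hFle hF0 (by norm_num)
      _ = 2 * K * β := by ring
  refine ⟨hzle, ⟨hF0, hFle⟩, hS0.trans hS0K, ?_, ⟨hlampos, hlamle2, hlam1⟩, ?_⟩
  · -- `|Σ|x|²Π| ≤ K β₁`
    refine hS2.trans ?_
    rw [hK]
    nlinarith
  · rw [hμ]
    exact ⟨by linarith, by linarith, by linarith⟩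

/-! ## `S_μ ≤ S_1` for `μ ∈ [0,1]` (transience) -/

/-- **`0 ≤ S_μ(x) ≤ S_1(x)` for `0 ≤ μ ≤ 1`** once the series `Σ_n D^{*n}(x)` converges
(transience, `summable_convPow` of `LaceExpansionIsingRandomWalkBound.lean` for `d ≥ 3`, `L ≥ 1`):
the step "`S_{μ_z}(x) ≤ S_1(x)`" of (2.16). [cite: LiuSlade2026, (2.16)] -/
theorem soGreen_le_soGreen_one {μ : ℝ} (hμ0 : 0 ≤ μ) (hμ1 : μ ≤ 1) {x : Site d}
    (hs : Summable fun n : ℕ => convPow (soStep d L) n x) :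
    soGreen d L μ x ≤ soGreen d L 1 x := by
  unfold soGreen
  have hle : ∀ n, μ ^ n * convPow (soStep d L) n x ≤ 1 ^ n * convPow (soStep d L) n x := fun n =>
    mul_le_mul_of_nonneg_right (pow_le_pow_left₀ hμ0 hμ1 n) (convPow_nonneg n x)
  have hs1 : Summable fun n => (1 : ℝ) ^ n * convPow (soStep d L) n x := by
    simpa only [one_pow, one_mul] using hs
  have hsμ : Summable fun n => μ ^ n * convPow (soStep d L) n x :=
    Summable.of_nonneg_of_le (fun n => mul_nonneg (pow_nonneg hμ0 n) (convPow_nonneg n x)) hle hs1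
  exact hsμ.tsum_le_tsum hle hs1

/-- `S_1(x) = Σ_n D^{*n}(x)` (the `μ = 1` series has no powers). [cite: LiuSlade2026, (1.6)] -/
theorem soGreen_one_eq (x : Site d) : soGreen d L 1 x = ∑' n : ℕ, convPow (soStep d L) n x := by
  unfold soGreen; simp only [one_pow, one_mul]

end Estimates

end Literature.Barriers.CriticalPhenomena.SpreadOutIsing

end
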